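import Summits.AtomisticToContinuum.Crystallization.Theorems.PricedLinkCensusTruncatedCensusGapBarlowIdentTruncLJ
import Summits.AtomisticToContinuum.Crystallization.Theorems.PricedLinkCensusTruncatedCensusGapHcpLeBarlow

/-!
# `TruncatedCensusGap` (stmt-AtomisticToContinuum-14230): hcp minimises the `V_χ` energy within the Barlow family at fixed scale

Lead c3 of line `sharp-m-potential-compactness`, composition of the landed wave-5 sub-goals
(`energyPerParticle_barlow_truncLJ_eq_average`, the Barlow energy identification for the range-2
potential, and `energyPerParticle_hcp_le_barlow_truncLJ_of_ident`):

`energyPerParticle_hcp_le_barlow_truncLJ` — for every in-layer spacing `a > 0`, layer spacing `h`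
with `3h ≥ 2`, and every periodic Hägg word `s`, if the second interlayer coupling
`J₂(a,h) = barlowCoupling V_χ a h 2` is `≤ 0` then the hcp stacking at `(a, h)` has energy per
particle `≤` that of the stacking of `s` at `(a, h)`.  (Affine stacking law p129223: the couplings
beyond the second layer vanish for the range-2 potential, `e(word) = e₀(a,h) + J₂(a,h)·α₂(word)`,
`α₂(hcp) = 1 ≥ α₂(word)`.)  This is the intra-Barlow, fixed-scale half of the charge-free optimality
piece CF-OPT of the hcp-reference split (p129121); the sign `J₂(a*,h*) < 0` (numerically `≈ −2.5e-4`)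
and the optimisation over `(a, h)` are certified-numerics business.  `[folklore]`.
-/

noncomputable section

namespace Summit.AtomisticToContinuum.Crystallization.Theorems.PricedLinkCensusTruncatedCensusGap

open Literature.MathematicalPhysics.StatisticalMechanics

/-- **hcp is optimal within the Barlow family at fixed `(a, h)` when `J₂(a,h) ≤ 0`** (range-2
truncated Lennard-Jones potential, `3h ≥ 2`). [folklore] -/
theorem energyPerParticle_hcp_le_barlow_truncLJ : ∀ (a h : ℝ) (s : ℤ → ℤ) (p : ℕ) (ha : a ≠ 0) (hh : h ≠ 0) (hp : p ≠ 0) (hs : ∀ i : ℤ, s (i + p) = s i), 0 < a → 2 ≤ 3 * h → IsHaggSeq s → barlowCoupling (fun r => min 1 (max 0 (4 - 2 * r)) * lennardJones r) a h 2 ≤ 0 → (hcpPeriodicConfiguration ha hh).energyPerParticle (fun r => min 1 (max 0 (4 - 2 * r)) * lennardJones r) ≤ (barlowPeriodicConfiguration s ha hh hp hs).energyPerParticle (fun r => min 1 (max 0 (4 - 2 * r)) * lennardJones r) :=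
  energyPerParticle_hcp_le_barlow_truncLJ_of_ident energyPerParticle_barlow_truncLJ_eq_average

end Summit.AtomisticToContinuum.Crystallization.Theorems.PricedLinkCensusTruncatedCensusGap

end
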